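import Mathlib.LinearAlgebra.Matrix.Permanent
import Mathlib.Computability.Encoding
import Mathlib.Computability.Language
import Mathlib.Data.Nat.Sqrt
import Literature.Computability.Complexity.BoolEncodings
import Literature.Computability.Complexity.ListFoldBricks
import HarnessLib

/-!
# Route PermanentDescent, crux `CollapseMakesPermanentEasy` (stmt-PneNP-16142), line `birth`:
# the Laplace certificate for permanent tables — objects (definitions only)

Objects of the uniformization half of the line (`stub_uniformizationUnderCollapse` = route item
stmt-PneNP-16145 `UniformizationUnderCollapse`: `NP ⊆ P → PermBits ∈ P/poly → PermBits ∈ P`), cut into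
registered stubs of the skeleton `Cruxes/CollapseMakesPermanentEasy/Lines/birth.lean` (v2). The argument
(Karp–Lipton-type search-to-decision in the collapsed hierarchy, certified by the permanent's Laplace
self-reduction; route header "ALGORITHM DESIGN IN ALGORITHMICA"):

* `P/poly = P` with polynomial advice (`PPoly_eq_polyAdvice_P_holds`): `x ∈ PermBits ↔ ⟨x, a |x|⟩ ∈ L'`
  for some `L' ∈ P`, advice `a`. A TABLE `W : List (List Bool)` of candidate advice strings indexed
  by query length answers the bit queries `⟨s, bin i⟩` through `L'` (`ansT`), hence assigns to every
  matrix word `s` a VALUE `valT` (the number whose binary digits are the answers for `i < B`).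
* The table is GOOD up to side `n` (`GoodT`, bound `N = n²` on `|s|`) when its values satisfy the
  Laplace row expansion of the permanent at every square word (`rhsT`: value `1` at the empty word,
  `Σ_j s₀ⱼ · valT (minor_{0j} s)` at side `k + 1`, minors in the word encoding `minorWord`). By
  induction on the side a good table's values ARE the permanents (`permWord`), so its answers are the
  true bits (soundness stub); the table of the true advice strings (`advTable`) is good (completeness
  stub); both rest on the Laplace identity in the word encoding
  `permWord (k+1) s = laplaceSum k s (permWord k)` (Laplace stub, from `Matrix.permanent_eq_sum_row_zero`).
* Goodness is a `∀`-statement over words of length `≤ n² ≤ |x|` with a polynomial-time matrix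
  (`checkB`, machine stubs via the `CodeFP` calculus), so the relation `relR` of pairs
  `⟨x, table code⟩` is in `polyForall P = coNP ⊆ P` under `NP ⊆ P`; the tree's suffix search
  (`exists_searchFn_of_NP_subset_P`) then FINDS a good table in polynomial time, and the decider
  `decideB` parses the query (`wfB`), reads the answer off the found table, and is in `P`.

Only objects are declared here (no facts): the statements about them are the registered stubs and
land as `PermanentDescentCollapseMakesPermanentEasyStub*.lean`; the composition lives in the skeleton.
`PermBits` is the crux's `let`-bound language, hoisted verbatim (so `Iff.rfl` identifies it with the
route items). Sources: R. M. Karp, R. J. Lipton, STOC 1980, Thm. 6.1 (search-to-decision under a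
collapse); S. Arora, B. Barak, *Computational Complexity* (2009), Thm. 2.18, Thm. 5.4, Thm. 6.18–6.19;
H. Minc, *Permanents* (1978), §1.2 (Laplace expansion; tree `Matrix.permanent_eq_sum_row_zero`).
-/

set_option linter.dupNamespace false -- `Summit.PneNP.PneNP.…`: summit = sub-problem name (D-0017 single-conjunct layout)

namespace Summit.PneNP.PneNP.Theorems.PermCert

open _root_.Computability Literature.Computability.Complexity Literature.Computability.Complexity.Brick

/-! ### §1 The crux's language and the permanent of a matrix word -/

/-- **`PermBits`, hoisted verbatim from the route items of `PermanentDescent`**: the words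
`⟨s, bin i⟩` with `|s| = n²` such that bit `i` of the permanent (over `ℕ`) of the row-major 0/1 matrix
`M_s(a, b) = s[b + n·a]` is `1`. [folklore] -/
def PermBits : Language Bool :=
  {w | ∃ (n : ℕ) (s : List Bool) (i : ℕ), s.length = n * n ∧
    w = Literature.Computability.Complexity.boolPair s (Computability.encodeNat i) ∧
      Nat.testBit (Matrix.permanent (Matrix.of fun a b : Fin n =>
        if s.getD ((b : ℕ) + n * (a : ℕ)) false then (1 : ℕ) else 0)) i = true}

/-- The `m × m` row-major 0/1 matrix over `ℕ` of a word (entry `(a, b)` = letter `b + m·a`, `false`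
past the end; the crux's encoding). [folklore] -/
def matOfWord (m : ℕ) (s : List Bool) : Matrix (Fin m) (Fin m) ℕ :=
  Matrix.of fun a b : Fin m => if s.getD ((b : ℕ) + m * (a : ℕ)) false then (1 : ℕ) else 0

/-- The permanent of the word's `m × m` matrix. [folklore] -/
def permWord (m : ℕ) (s : List Bool) : ℕ :=
  (matOfWord m s).permanent

/-- **Minor in the word encoding**: the row-major word (side `k`) of the minor of the `(k+1) × (k+1)`
matrix word `s` obtained by deleting row `0` and column `j` — letter `t` (`t = b + k·a`) is
`s[(b + [j ≤ b]) + (k+1)·(a+1)]`. [folklore] -/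
def minorWord (k j : ℕ) (s : List Bool) : List Bool :=
  (List.range (k * k)).map fun t =>
    s.getD (t % k + (if j ≤ t % k then 1 else 0) + (k + 1) * (t / k + 1)) false

/-- **Laplace right-hand side along row `0`** of a `(k+1) × (k+1)` matrix word `s`, with the minors
valued by `v`: `Σ_{j ≤ k} s[j] · v (minorWord k j s)` (row `0` of `s` is its first `k + 1` letters). [folklore] -/
def laplaceSum (k : ℕ) (s : List Bool) (v : List Bool → ℕ) : ℕ :=
  ((List.range (k + 1)).map fun j => if s.getD j false then v (minorWord k j s) else 0).sum

/-! ### §2 Tables of advice strings and their values -/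

/-- **Answer of the table `W` to the bit query `⟨s, bin i⟩`** through the advice-taking predicate `χ`:
the query is paired with the table entry indexed by its length. [folklore] -/
def ansT (χ : List Bool → Bool) (W : List (List Bool)) (s : List Bool) (i : ℕ) : Bool :=
  χ (boolPair (boolPair s (encodeNat i)) (W.getD (boolPair s (encodeNat i)).length []))

/-- **Value of the word `s` read off the table**: the number whose binary digits (least significant
first) are the answers to the queries `i < B`. [folklore] -/
def valT (χ : List Bool → Bool) (W : List (List Bool)) (B : ℕ) (s : List Bool) : ℕ :=
  bitsToNat ((List.range B).map fun i => ansT χ W s i)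

/-- **Certified right-hand side** for the word `s`: `1` at the empty word, otherwise the Laplace sum
at side `√|s|` with the minors valued by the table. [folklore] -/
def rhsT (χ : List Bool → Bool) (W : List (List Bool)) (B : ℕ) (s : List Bool) : ℕ :=
  if s.length = 0 then 1 else laplaceSum (Nat.sqrt s.length - 1) s (valT χ W B)

/-- **Good tables**: the table's values pass the Laplace test at every square word of length `≤ N`. [folklore] -/
def GoodT (χ : List Bool → Bool) (W : List (List Bool)) (B N : ℕ) : Prop :=
  ∀ s : List Bool, Nat.sqrt s.length * Nat.sqrt s.length = s.length → s.length ≤ N →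
    valT χ W B s = rhsT χ W B s

/-- Length of the table serving all queries of side `≤ n` and bit index `≤ n²`
(every such query `⟨s, bin i⟩` has length `2|s| + 2 + |bin i| ≤ 3n² + 2`). [folklore] -/
def tabLen (n : ℕ) : ℕ :=
  3 * (n * n) + 4

/-- **The table of the true advice strings** `a 0, …, a (tabLen n - 1)`. [folklore] -/
def advTable (a : ℕ → List Bool) (n : ℕ) : List (List Bool) :=
  (List.range (tabLen n)).map a

/-! ### §3 The certificate as a polynomial-time matrix, the search relation, the decider -/

/-- **The matrix of the certificate**: for the query `x` (whose first component has length `n²`),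
the table code `w` (decoded totally by `decNil`) and a word `y`: if `y` is a square word of length
`≤ |x.1|` then the table (bit budget `B = |x.1| + 1`) passes the Laplace test at `y`. [folklore] -/
def checkB (χ : List Bool → Bool) (x w y : List Bool) : Bool :=
  decide ((Nat.sqrt y.length * Nat.sqrt y.length = y.length ∧ y.length ≤ (fstF x).length) →
    valT χ (decNil w) ((fstF x).length + 1) y = rhsT χ (decNil w) ((fstF x).length + 1) y)

/-- The matrix language `{⟨⟨x, w⟩, y⟩ | checkB χ x w y}`. [folklore] -/
def matLang (χ : List Bool → Bool) : Language Bool :=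
  {u | checkB χ (fstF (fstF u)) (sndF (fstF u)) (sndF u) = true}

/-- **The search relation** `{⟨x, w⟩ | ∀ y, |y| ≤ |⟨x, w⟩| → checkB χ x w y}` (a `polyForall` of the
matrix language: the table decoded from `w` is good for the query `x`). [folklore] -/
def relR (χ : List Bool → Bool) : Language Bool :=
  {z | ∀ y : List Bool, y.length ≤ z.length → checkB χ (fstF z) (sndF z) y = true}

/-- **Well-formed queries**: `x = ⟨s, bin i⟩` with `|s|` a perfect square (re-pair the total
projections and compare). [folklore] -/
def wfB (x : List Bool) : Bool :=
  decide (boolPair (fstF x) (encodeNat (bitsToNat (sndF x))) = x ∧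
    Nat.sqrt (fstF x).length * Nat.sqrt (fstF x).length = (fstF x).length)

/-- **The decider** built from a table-finding function `g`: accept `x = ⟨s, bin i⟩` iff it is well
formed, `i ≤ |s|`, and the table decoded from `g x` answers the query positively. [folklore] -/
def decideB (χ : List Bool → Bool) (g : List Bool → List Bool) (x : List Bool) : Bool :=
  wfB x && (decide (bitsToNat (sndF x) < (fstF x).length + 1) &&
    ansT χ (decNil (g x)) (fstF x) (bitsToNat (sndF x)))

end Summit.PneNP.PneNP.Theorems.PermCert
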